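import Mathlib
import HarnessLib
import Summits.HubbardSuperconductivity.HubbardSuperconductivity.Theorems.KLProgrammeKLRegimeSectorSliceGramFatAnnulus

/-!
# Route `KLProgramme` — ENGINE child gen 8 (stmt-HubbardSuperconductivity-20437 `KLRegimeEngineV17F2`), skeleton v2 class #3 witness input GAP L2-c:
# β-UNIFORM entry bound, Gram half-norms and replica-Gram constant of the fat-sectorised line of ANY SOFT-SHAPED symbol
# `‖p(k,σ)‖ ≤ A_p·βL²/ρ_K(k)` (bare soft covariance: `A_p = 1`; p5's DRESSED soft line `klE5SoftLineSym`: `A_p = 8` by `norm_klE5SoftLineSym_le`)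
# (cell gate-hubbard-kl, seat hubbard-kl-k3c2-p2 g9, value/(T) lane; companion of …SectorSliceGramFatAnnulus)

For the fat family `Ft = bgmFatMultiplier L M e₀ β (nambuXiCT L μ K) (m+1)` on an admissible frame (the `μ`-frame data `B, A` of the fat pack and a
coordinate-gradient floor `λ` of the frame band on `{|e_K| ≤ Λ_m}`), and ANY symbol `p` with `‖p(ks)‖ ≤ A_p·βL²/√(ω² + e_K²)` wherever `p(ks) ≠ 0`:

* `radius_mem_of_bgmFat_ne_zero` — on the support of `Ft_ω`, `π/β ≤ ρ_K(k) ≤ Λ_m` (first fermionic frequency; `bgmFat_support_shell`);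
* **`norm_entry_softShaped_bgmFat_sharp_le`** — `‖(S(Ft)ᵀ·normalCovariance p·S(Ft)) Y Y′‖ ≤ ‖(βL²)⁻¹‖²·(4·(A_p·βL²)·C_ann·Λ_m)` (g8's
  `norm_sectorSub_pullback_normalCovariance_le_of_dyadic` + `card_annulus_bgmFat_le_sq`);
* **`norm_sq_sectorGramF/G_softShaped_bgmFat_sharp_le`**, **`isGramBoundedR_softShaped_bgmFat_sharp`** — the same number bounds `‖F_Y‖²`, `‖G_{Y′}‖²`
  and is the square of a replica-Gram constant (…SectorGramHalfNormSum).

`C_ann = (8β/π)(ρ_f L/π + 1)(8π(4+4A)/λ + 1)(4L/(πλ) + 2β/π)` as in …SectorSliceGramFatAnnulus; in the regime `‖(βL²)⁻¹‖²·4βL²·C_ann·Λ_m ≤ 4Cκ·e₀·8^{-(m+1)}`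
(…SectorGramSoftShapedSharp).  Everything is proved; no definitions, no named facts. [cite: BenfattoGiulianiMastropietro2006, §2.7 (2.66)–(2.67), §2.8 (2.80)]
-/

noncomputable section

namespace Summit.HubbardSuperconductivity.HubbardSuperconductivity.Theorems.TorusFourierL2

set_option linter.dupNamespace false -- summit = problem name (single-conjunct summit), D-0017

open Set Finset Literature.MathematicalPhysics.QuantumLattice Literature.MathematicalPhysics.QuantumLattice.BandSectorCounting
open Literature.MathematicalPhysics.QuantumLattice.FermiRG Literature.Probability.LatticeModels Literature.Analysis.SpecialFunctions
open Summit.HubbardSuperconductivity.HubbardSuperconductivity.Theorems.DispersionFlow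
open Summit.HubbardSuperconductivity.HubbardSuperconductivity.Theorems.KLRegimeSplit
open Summit.HubbardSuperconductivity.HubbardSuperconductivity.Theorems.KLProgrammeLegKernels
open Summit.HubbardSuperconductivity.HubbardSuperconductivity.Theorems.PerturbedFermiCurve
open scoped Real Nat

section SoftShaped

open Classical

variable {L M : ℕ} [NeZero L] {a b : ℝ} (B : BandBounds a b) {K : TrigPolyC4v} {A : ℝ}
  (hA : ∀ p : Momentum, ∀ j ≤ 2, ‖iteratedFDeriv ℝ j (frameShift K) p‖ ≤ A) (hADt : 2 * A < B.Dtmin)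
  {μ e₀ β : ℝ} (he : 0 < e₀) (hgap : e₀ + A < -μ) (hlo : a ≤ μ - A - e₀) (hhi : μ + A + e₀ ≤ b) (hβ : 0 < β) (m : ℕ)
  {lam : ℝ} (hlam : 0 < lam)
  (hgradK : ∀ p : Fin 2 → ℝ, |frameLevel μ K (WithLp.toLp 2 p)| ≤ klScale e₀ m →
    lam ≤ |fderiv ℝ (fun q : Fin 2 → ℝ => frameLevel μ K (WithLp.toLp 2 q)) p (Pi.single 0 1)| ∨
      lam ≤ |fderiv ℝ (fun q : Fin 2 → ℝ => frameLevel μ K (WithLp.toLp 2 q)) p (Pi.single 1 1)|)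

include he hβ in
omit [NeZero L] in
/-- **Radial support of one fat multiplier**: `Ft_ω(k) ≠ 0 ⇒ π/β ≤ ρ_K(k) ≤ Λ_m` (`ρ_K = √(ω² + e_K²)`: the first fermionic frequency below, the
radial plateau `G_m` above). [cite: BenfattoGiulianiMastropietro2006, §2.7 (2.66)] -/
theorem radius_mem_of_bgmFat_ne_zero (ω : Fin (sectorCount (m + 1))) (k : FreqMomentum L M)
    (h : bgmFatMultiplier L M e₀ β (nambuXiCT L μ K) (m + 1) ω k ≠ 0) :
    π / β ≤ Real.sqrt (matsubaraFreq β M k.1 ^ 2 + nambuXiCT L μ K k.2 ^ 2) ∧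
      Real.sqrt (matsubaraFreq β M k.1 ^ 2 + nambuXiCT L μ K k.2 ^ 2) ≤ klScale e₀ m := by
  constructor
  · refine (pi_div_le_abs_matsubaraFreq hβ k.1 (M := M)).trans ?_
    rw [← Real.sqrt_sq_eq_abs]
    exact Real.sqrt_le_sqrt (by nlinarith [sq_nonneg (nambuXiCT L μ K k.2)])
  · have hsh := bgmFat_support_shell (L := L) (M := M) (μ := μ) (β := β) he m ω k h
    have h0 : 0 ≤ klScale e₀ m := by rw [klScale]; positivity
    rw [← Real.sqrt_sq h0]
    exact Real.sqrt_le_sqrt hsh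

include B hA hADt he hgap hlo hhi hβ hlam hgradK in
/-- **β-uniform entry bound of the fat-sectorised line of a soft-shaped symbol**: if `‖p(ks)‖ ≤ A_p·βL²/ρ_K(ks)` wherever `p(ks) ≠ 0` then
`‖(S(Ft)ᵀ·normalCovariance p·S(Ft)) Y Y′‖ ≤ ‖(βL²)⁻¹‖²·(4·(A_p·βL²)·C_ann·Λ_m)`. [cite: BenfattoGiulianiMastropietro2006, §2.7 (2.66)–(2.67)] -/
theorem norm_entry_softShaped_bgmFat_sharp_le [NeZero M] (p : FreqMomentum L M × Fin 2 → ℂ) {Ap : ℝ} (hAp : 0 ≤ Ap)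
    (hp : ∀ ks, p ks ≠ 0 → ‖p ks‖ ≤ Ap * (β * (L : ℝ) ^ 2) / Real.sqrt (matsubaraFreq β M ks.1.1 ^ 2 + nambuXiCT L μ K ks.1.2 ^ 2))
    (Y Y' : SpaceTimeIdx L M × SectorLeg (sectorCount (m + 1))) :
    ‖((sectorSubMatrix L M β (bgmFatMultiplier L M e₀ β (nambuXiCT L μ K) (m + 1))).transpose * normalCovariance L M p *
        sectorSubMatrix L M β (bgmFatMultiplier L M e₀ β (nambuXiCT L μ K) (m + 1))) Y Y'‖ ≤
      ‖((1 / (β * (L : ℝ) ^ 2) : ℝ) : ℂ)‖ ^ 2 * (4 * (Ap * (β * (L : ℝ) ^ 2)) *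
        ((8 * β / π) * (((klScale e₀ m + B.smax * B.Dtmin * (3 * sectorWidth (m + 1) / 4)) / (B.Dtmin - 2 * A) +
              π * Real.sqrt 2 * (1 + (4 + 2 * A) / (B.Dtmin - 2 * A)) * sectorWidth (m + 1)) * L / π + 1) *
          ((8 * π * (4 + 4 * A) / lam + 1) * (4 * L / (π * lam) + 2 * β / π))) * klScale e₀ m) := by
  have hΛm : 0 < klScale e₀ m := by rw [klScale]; positivity
  refine norm_sectorSub_pullback_normalCovariance_le_of_dyadic β _ (fun _ _ => norm_bgmFatMultiplier_le_one _ _ _ _ _ _) p Y Y'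
    (fun k => Real.sqrt (matsubaraFreq β M k.1 ^ 2 + nambuXiCT L μ K k.2 ^ 2)) hΛm (by positivity : 0 < π / β) (by positivity)
    (annulusConst_bgmFat_nonneg B hA hADt he hgap hlo hhi hβ m hlam hgradK) (fun k _ => ?_)
    (fun k hk => radius_mem_of_bgmFat_ne_zero (L := L) (M := M) he hβ m _ k hk)
    (fun _ hr hrΛ => card_annulus_bgmFat_le_sq (L := L) (M := M) B hA hADt he hgap hlo hhi hβ m hlam hgradK Y.2.1.1 hr hrΛ)
  by_cases h0 : p (k, Y.2.1.2) = 0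
  · rw [h0, norm_zero]; positivity
  · exact hp (k, Y.2.1.2) h0

include B hA hADt he hgap hlo hhi hβ hlam hgradK in
/-- **β-uniform left Gram half-norm of the fat-sectorised line of a soft-shaped symbol**: `‖F_Y‖² ≤ ‖(βL²)⁻¹‖²·(4·(A_p·βL²)·C_ann·Λ_m)`.
[cite: BenfattoGiulianiMastropietro2006, §2.8 (2.80)] -/
theorem norm_sq_sectorGramF_softShaped_bgmFat_sharp_le (p : FreqMomentum L M × Fin 2 → ℂ) {Ap : ℝ} (hAp : 0 ≤ Ap)
    (hp : ∀ ks, p ks ≠ 0 → ‖p ks‖ ≤ Ap * (β * (L : ℝ) ^ 2) / Real.sqrt (matsubaraFreq β M ks.1.1 ^ 2 + nambuXiCT L μ K ks.1.2 ^ 2))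
    (Y : SpaceTimeIdx L M × SectorLeg (sectorCount (m + 1))) :
    ‖sectorGramF L M β (bgmFatMultiplier L M e₀ β (nambuXiCT L μ K) (m + 1)) p Y‖ ^ 2 ≤
      ‖((1 / (β * (L : ℝ) ^ 2) : ℝ) : ℂ)‖ ^ 2 * (4 * (Ap * (β * (L : ℝ) ^ 2)) *
        ((8 * β / π) * (((klScale e₀ m + B.smax * B.Dtmin * (3 * sectorWidth (m + 1) / 4)) / (B.Dtmin - 2 * A) +
              π * Real.sqrt 2 * (1 + (4 + 2 * A) / (B.Dtmin - 2 * A)) * sectorWidth (m + 1)) * L / π + 1) *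
          ((8 * π * (4 + 4 * A) / lam + 1) * (4 * L / (π * lam) + 2 * β / π))) * klScale e₀ m) := by
  have hΛm : 0 < klScale e₀ m := by rw [klScale]; positivity
  exact norm_sq_sectorGramF_le_of_dyadic β _ (fun _ _ => norm_bgmFatMultiplier_le_one _ _ _ _ _ _) p Y
    (fun k => Real.sqrt (matsubaraFreq β M k.1 ^ 2 + nambuXiCT L μ K k.2 ^ 2)) hΛm (by positivity : 0 < π / β) (by positivity)
    (annulusConst_bgmFat_nonneg B hA hADt he hgap hlo hhi hβ m hlam hgradK) (fun k _ hpk => hp (k, Y.2.1.2) hpk)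
    (fun k hk _ => radius_mem_of_bgmFat_ne_zero (L := L) (M := M) he hβ m _ k hk)
    (fun _ hr hrΛ => card_annulus_bgmFat_le_sq (L := L) (M := M) B hA hADt he hgap hlo hhi hβ m hlam hgradK Y.2.1.1 hr hrΛ)

include B hA hADt he hgap hlo hhi hβ hlam hgradK in
/-- **β-uniform right Gram half-norm of the fat-sectorised line of a soft-shaped symbol**: `‖G_{Y′}‖² ≤ ‖(βL²)⁻¹‖²·(4·(A_p·βL²)·C_ann·Λ_m)`.
[cite: BenfattoGiulianiMastropietro2006, §2.8 (2.80)] -/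
theorem norm_sq_sectorGramG_softShaped_bgmFat_sharp_le (p : FreqMomentum L M × Fin 2 → ℂ) {Ap : ℝ} (hAp : 0 ≤ Ap)
    (hp : ∀ ks, p ks ≠ 0 → ‖p ks‖ ≤ Ap * (β * (L : ℝ) ^ 2) / Real.sqrt (matsubaraFreq β M ks.1.1 ^ 2 + nambuXiCT L μ K ks.1.2 ^ 2))
    (Y' : SpaceTimeIdx L M × SectorLeg (sectorCount (m + 1))) :
    ‖sectorGramG L M β (bgmFatMultiplier L M e₀ β (nambuXiCT L μ K) (m + 1)) p Y'‖ ^ 2 ≤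
      ‖((1 / (β * (L : ℝ) ^ 2) : ℝ) : ℂ)‖ ^ 2 * (4 * (Ap * (β * (L : ℝ) ^ 2)) *
        ((8 * β / π) * (((klScale e₀ m + B.smax * B.Dtmin * (3 * sectorWidth (m + 1) / 4)) / (B.Dtmin - 2 * A) +
              π * Real.sqrt 2 * (1 + (4 + 2 * A) / (B.Dtmin - 2 * A)) * sectorWidth (m + 1)) * L / π + 1) *
          ((8 * π * (4 + 4 * A) / lam + 1) * (4 * L / (π * lam) + 2 * β / π))) * klScale e₀ m) := by
  have hΛm : 0 < klScale e₀ m := by rw [klScale]; positivity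
  exact norm_sq_sectorGramG_le_of_dyadic β _ (fun _ _ => norm_bgmFatMultiplier_le_one _ _ _ _ _ _) p Y'
    (fun k => Real.sqrt (matsubaraFreq β M k.1 ^ 2 + nambuXiCT L μ K k.2 ^ 2)) hΛm (by positivity : 0 < π / β) (by positivity)
    (annulusConst_bgmFat_nonneg B hA hADt he hgap hlo hhi hβ m hlam hgradK) (fun k _ hpk => hp (k, Y'.2.1.2) hpk)
    (fun k hk _ => radius_mem_of_bgmFat_ne_zero (L := L) (M := M) he hβ m _ k hk)
    (fun _ hr hrΛ => card_annulus_bgmFat_le_sq (L := L) (M := M) B hA hADt he hgap hlo hhi hβ m hlam hgradK Y'.2.1.1 hr hrΛ)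

include B hA hADt he hgap hlo hhi hβ hlam hgradK in
/-- **β-uniform replica-Gram constant of the fat-sectorised line of a soft-shaped symbol**:
`IsGramBoundedR (S(Ft)ᵀ·normalCovariance p·S(Ft)) √(‖(βL²)⁻¹‖²·(4·(A_p·βL²)·C_ann·Λ_m))`. [cite: BenfattoGiulianiMastropietro2006, §2.8 (2.80)] -/
theorem isGramBoundedR_softShaped_bgmFat_sharp [NeZero M] (p : FreqMomentum L M × Fin 2 → ℂ) {Ap : ℝ} (hAp : 0 ≤ Ap)
    (hp : ∀ ks, p ks ≠ 0 → ‖p ks‖ ≤ Ap * (β * (L : ℝ) ^ 2) / Real.sqrt (matsubaraFreq β M ks.1.1 ^ 2 + nambuXiCT L μ K ks.1.2 ^ 2)) :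
    IsGramBoundedR ((sectorSubMatrix L M β (bgmFatMultiplier L M e₀ β (nambuXiCT L μ K) (m + 1))).transpose * normalCovariance L M p *
        sectorSubMatrix L M β (bgmFatMultiplier L M e₀ β (nambuXiCT L μ K) (m + 1)))
      (Real.sqrt (‖((1 / (β * (L : ℝ) ^ 2) : ℝ) : ℂ)‖ ^ 2 * (4 * (Ap * (β * (L : ℝ) ^ 2)) *
        ((8 * β / π) * (((klScale e₀ m + B.smax * B.Dtmin * (3 * sectorWidth (m + 1) / 4)) / (B.Dtmin - 2 * A) +
              π * Real.sqrt 2 * (1 + (4 + 2 * A) / (B.Dtmin - 2 * A)) * sectorWidth (m + 1)) * L / π + 1) *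
          ((8 * π * (4 + 4 * A) / lam + 1) * (4 * L / (π * lam) + 2 * β / π))) * klScale e₀ m))) := by
  refine isGramBoundedR_of_halfNorm_le β _ p (Real.sqrt_nonneg _) (fun Y => ?_) (fun Y' => ?_)
  · rw [← Real.sqrt_sq (norm_nonneg (sectorGramF L M β _ p Y))]
    exact Real.sqrt_le_sqrt (norm_sq_sectorGramF_softShaped_bgmFat_sharp_le B hA hADt he hgap hlo hhi hβ m hlam hgradK p hAp hp Y)
  · rw [← Real.sqrt_sq (norm_nonneg (sectorGramG L M β _ p Y'))]
    exact Real.sqrt_le_sqrt (norm_sq_sectorGramG_softShaped_bgmFat_sharp_le B hA hADt he hgap hlo hhi hβ m hlam hgradK p hAp hp Y')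

end SoftShaped

end Summit.HubbardSuperconductivity.HubbardSuperconductivity.Theorems.TorusFourierL2

end
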